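import Literature.NumberTheory.EllipticCurves.SelmerInftyTorsionFiniteProofs
import Summits.BirchSwinnertonDyer.Rank1Residual.X11b.CoinvariantsLocal
import HarnessLib

/-!
# Route UniversalToricDescent — the LOCAL KUMMER KERNEL, counted:
# `#ker(H¹(G, E[p]) → H¹(G, E[p^∞])) = #(E[p^∞]^G / p·E[p^∞]^G)`, and `= #E[p]^G` when `E[p^∞]^G` is finite

Lead prover bsd-wall-utd-p1 g13 (`--supports` ♭T′ stmt-BirchSwinnertonDyer-26975; step (γa) of the (L)-free residual
comparison (M1) of stub B′ `stub_lambdaTransportPT`, memo RESIDUE-B-PRIME-utdp1g13 §3). The exact residual comparison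
`#Sel_𝔭^Σ(K_∞, E[p^∞])[p] = #Sel_𝔭^Σ(K_∞, E′[p^∞])[p]` of the tree (`natCard_selmerAc_pTorsion_eq_of_torsionIso`) needs
(L) «`E(K_{∞,𝔭})[p] = 0`» only to make the local Kummer map `H¹(K_{∞,𝔭}, E[p]) → H¹(K_{∞,𝔭}, E[p^∞])` injective.
Without (L) its kernel is the connecting image `T_𝔭(E) = E(K_{∞,𝔭})[p^∞] ⊗ ℤ/p`, and the (L)-free count needs
`#T_𝔭(E) = #T_𝔭(E′)`. This file computes the kernel for ANY subgroup `G = H ≤ D ≤ Γ_K` of a decomposition-type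
subgroup (the shape `H = kerD κ 𝔭 ≤ D_𝔭` of the tree's local restriction `resKerD`):

* `natCard_ker_kummer_eq_natCard_quotient` — **`#ker(ι_G) = #(B/pB)`**, `B = E[p^∞]^G`: the map `β ↦ [∂ b]` (`p b = β`)
  is a homomorphism `B → H¹(G, E[p])` with kernel `pB` and image `ker ι_G` (the cocycle bookkeeping of the Literature
  theorem `WeierstrassCurve.finite_ker_torsionToPrimaryH1Sub`, upgraded from "finite" to an exact count);
* `natCard_quotient_eq_natCard_pTorsion_of_finite` — for FINITE `B`: `#(B/pB) = #B[p]` (kernel and cokernel of `p`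
  on a finite abelian group have the same order);
* `natCard_ker_kummer_eq_natCard_fixed_torsion` — hence **`#ker(ι_G) = #E[p]^G`** when `E[p^∞]^G` is finite;
* `natCard_fixed_torsion_eq_of_torsionIso` — `#E₁[p]^G = #E₂[p]^G` along a `Γ_K`-equivariant `E₁[p] ≃ E₂[p]`.

So for two `p`-congruent curves whose local towers have FINITE `p`-primary torsion at the strict place (for the wild
curve on the O6 class: `localTowerTorsionFiniteClaim_three_of_classO6`; for the twin: the ordinary/multiplicative/
supersingular line analysis), the local Kummer kernels have the same order — the local input of the (L)-free count.
THEOREMS ONLY; no definition, no named fact, no `sorry`. BSD is not advanced by this file.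
References: [GreenbergVatsal2000] §2 Prop. (2.8) (pp. 26–27); [GreenbergLNM1716] §3 (proof of Lemma 3.1), §5 p. 114;
[SerreGaloisCohomology1997] I §2.4, §5.1.
-/

set_option autoImplicit false
-- `…BirchSwinnertonDyer.BirchSwinnertonDyer.Theorems…` is the problem's mandated namespace (D-0017).
set_option linter.dupNamespace false

noncomputable section

open scoped Classical

namespace Summit.BirchSwinnertonDyer.BirchSwinnertonDyer.Theorems.UniversalToricDescentLocalKummer

open CategoryTheory Field WeierstrassCurve
open Literature.NumberTheory.EllipticCurves Literature.NumberTheory.GaloisRepresentations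

variable {K : Type} [Field K] (W : WeierstrassCurve K) [W.IsElliptic] (p : ℕ) [Fact p.Prime]
  {D : Subgroup (absoluteGaloisGroup K)} (H : Subgroup D)

omit [W.IsElliptic] [Fact p.Prime] in
/-- Orbit maps of `E[p^∞]` under `H ≤ D ≤ Γ_K` are continuous. [folklore] -/
theorem continuous_smul_sub (b : W.geomPrimaryTorsion p) : Continuous fun σ : H ↦ σ • b := by
  have : (fun σ : H ↦ σ • b) =
      (fun σ : absoluteGaloisGroup K ↦ σ • b) ∘ fun σ : H ↦ ((σ : D) : absoluteGaloisGroup K) := by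
    ext σ; rfl
  rw [this]
  exact (W.continuous_smul_geomPrimaryTorsion p b).comp
    (continuous_subtype_val.comp continuous_subtype_val)

/-- **`#ker(H¹(G, E[p]) → H¹(G, E[p^∞])) = #(E[p^∞]^G / p·E[p^∞]^G)`** for any `G = H ≤ D ≤ Γ_K`. With `B = E[p^∞]^G`
and, for `β ∈ B`, an (admissible) root `p b = β`: `β ↦ [σ ↦ σ b − b]` is a well-defined homomorphism
`B → H¹(G, E[p])` (two admissible roots differing by `B + E[p]` give the same class), its image is exactly the kernel
of the Kummer map (a kernel class is `[∂ b]` with `p b ∈ B`), and its kernel is `pB` (`[∂ b] = 0` iff `b ∈ B + E[p]` iff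
`β ∈ pB`). (`Nat.card`; both sides `0` if infinite.) [cite: GreenbergLNM1716, §3 proof of Lemma 3.1, §5 p. 114]
[cite: SerreGaloisCohomology1997, I §5.1] -/
theorem natCard_ker_kummer_eq_natCard_quotient :
    Nat.card ((resH1Hom (ContinuousMonoidHom.id H)
        (AddSubgroup.inclusion (geomTorsion_le_geomPrimaryTorsion W p)) (fun _ _ ↦ rfl) :
          subgroupH1 H (geomTorsion W (p : ℤ)) →+ subgroupH1 H (W.geomPrimaryTorsion p)).ker) =
      Nat.card (FixedPoints.addSubgroup H (W.geomPrimaryTorsion p) ⧸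
        (DistribSMul.toAddMonoidHom (FixedPoints.addSubgroup H (W.geomPrimaryTorsion p)) p).range) := by
  have hdiv : W.zsmul_geomPoints_surjective := W.zsmul_geomPoints_surjective_holds
  set ι : subgroupH1 H (geomTorsion W (p : ℤ)) →+ subgroupH1 H (W.geomPrimaryTorsion p) :=
    resH1Hom (ContinuousMonoidHom.id H) (AddSubgroup.inclusion (geomTorsion_le_geomPrimaryTorsion W p))
      (fun _ _ ↦ rfl) with hιdef
  -- `B = E[p^∞]^G` and multiplication by `p` on it
  set B : AddSubgroup (geomPrimaryTorsion W p) := FixedPoints.addSubgroup H (geomPrimaryTorsion W p) with hB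
  set mulp : B →+ B := DistribSMul.toAddMonoidHom B p with hmulp
  have hmulp_apply : ∀ b : B, mulp b = p • b := fun _ ↦ rfl
  -- admissible `p`-th roots and their Kummer classes in `H¹(G, E[p])`
  let incl := AddSubgroup.inclusion (geomTorsion_le_geomPrimaryTorsion W p)
  have hmemB : ∀ (b : geomPrimaryTorsion W p), (∀ σ : H, σ • (p • b) = p • b) →
      ∀ σ : H, (((σ • b - b : geomPrimaryTorsion W p)) : geomPoints W) ∈ geomTorsion W (p : ℤ) := by
    intro b hb σ
    refine AddSubgroup.torsionBy.nsmul_iff.mpr ?_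
    rw [← AddSubgroupClass.coe_nsmul, smul_sub, smul_comm, hb σ, sub_self, ZeroMemClass.coe_zero]
  let coc : ∀ (b : geomPrimaryTorsion W p), (∀ σ : H, σ • (p • b) = p • b) →
      contOneCocycles (discreteTopRep H (geomTorsion W (p : ℤ))) := fun b hb ↦
    contOneCocycles.lift incl (fun _ _ ↦ rfl) (AddSubgroup.inclusion_injective _)
      (cobCocycle b (continuous_smul_sub W p H b)) (fun σ ↦ ⟨_, hmemB b hb σ⟩) (fun _ ↦ rfl)
  have hcoc : ∀ b hb (σ : H), (((coc b hb).1 σ : geomTorsion W (p : ℤ)) : geomPoints W) =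
      ((σ • b - b : geomPrimaryTorsion W p) : geomPoints W) := fun _ _ _ ↦ rfl
  -- the class of `coc b` only depends on `b` modulo `B + E[p]`
  have hcls : ∀ (b₁ b₂ : geomPrimaryTorsion W p) (hb₁ : ∀ σ : H, σ • (p • b₁) = p • b₁)
      (hb₂ : ∀ σ : H, σ • (p • b₂) = p • b₂) (β : geomPrimaryTorsion W p),
      (∀ σ : H, σ • β = β) → p • (b₁ - b₂ - β) = 0 →
      oneCocycleClass _ (coc b₁ hb₁) = oneCocycleClass _ (coc b₂ hb₂) := by
    intro b₁ b₂ hb₁ hb₂ β hβ hpe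
    have he : (((b₁ - b₂ - β : geomPrimaryTorsion W p)) : geomPoints W) ∈ geomTorsion W (p : ℤ) :=
      AddSubgroup.torsionBy.nsmul_iff.mpr (by rw [← AddSubgroupClass.coe_nsmul, hpe, ZeroMemClass.coe_zero])
    rw [← sub_eq_zero, ← oneCocycleClass_sub, oneCocycleClass_eq_zero_iff]
    refine ⟨⟨_, he⟩, fun σ ↦ ?_⟩
    apply Subtype.ext
    change (((coc b₁ hb₁).1 σ - (coc b₂ hb₂).1 σ : geomTorsion W (p : ℤ)) : geomPoints W) = _
    rw [AddSubgroupClass.coe_sub, hcoc b₁ hb₁, hcoc b₂ hb₂, ← AddSubgroupClass.coe_sub]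
    change _ = (((σ • (b₁ - b₂ - β) - (b₁ - b₂ - β) : geomPrimaryTorsion W p)) : geomPoints W)
    congr 1
    rw [smul_sub, smul_sub, hβ]
    abel
  -- the class of `coc b` dies under `ι` (it becomes the coboundary of `b`)
  have hιcoc : ∀ b hb, ι (oneCocycleClass _ (coc b hb)) = 0 := by
    intro b hb
    rw [hιdef, resH1Hom_id_oneCocycleClass, contOneCocycles.push_lift]
    exact oneCocycleClass_cobCocycle b _
  -- every kernel element is the class of an admissible root
  have hker : ∀ x ∈ ι.ker, ∃ b hb, x = oneCocycleClass _ (coc b hb) := by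
    intro x hx
    obtain ⟨φ, rfl⟩ := oneCocycleClass_surjective _ x
    rw [AddMonoidHom.mem_ker, hιdef, resH1Hom_id_oneCocycleClass, oneCocycleClass_eq_zero_iff] at hx
    obtain ⟨b, hb⟩ := hx
    have hb' : ∀ σ : H, incl (φ.1 σ) = σ • b - b := fun σ ↦ hb σ
    have hadm : ∀ σ : H, σ • (p • b) = p • b := fun σ ↦ by
      have h1 : p • (σ • b - b) = 0 := by
        rw [← hb' σ, ← map_nsmul]
        have : p • φ.1 σ = 0 := Subtype.ext (by
          rw [AddSubgroupClass.coe_nsmul, ZeroMemClass.coe_zero]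
          exact AddSubgroup.torsionBy.nsmul_iff.mp (φ.1 σ).2)
        rw [this, map_zero]
      rw [smul_sub, smul_comm, sub_eq_zero] at h1
      exact h1
    refine ⟨b, hadm, congrArg _ (Subtype.ext (ContinuousMap.ext fun σ ↦ ?_))⟩
    apply AddSubgroup.inclusion_injective (geomTorsion_le_geomPrimaryTorsion W p)
    change incl (φ.1 σ) = incl ((coc b hadm).1 σ)
    rw [hb' σ]
    rfl
  -- roots of elements of `B`
  have hroot : ∀ β : B, ∃ b : geomPrimaryTorsion W p, p • b = (β : geomPrimaryTorsion W p) := fun β ↦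
    exists_nsmul_eq_geomPrimaryTorsion W p hdiv _
  choose root hroot using hroot
  have hadm_root : ∀ β : B, ∀ σ : H, σ • (p • root β) = p • root β := fun β σ ↦ by
    rw [hroot]; exact β.2 σ
  -- the homomorphism `θ : B → H¹(G, E[p])`, `β ↦ [∂ root β]`
  have hadd : ∀ β₁ β₂ : B, oneCocycleClass _ (coc (root (β₁ + β₂)) (hadm_root (β₁ + β₂))) =
      oneCocycleClass _ (coc (root β₁) (hadm_root β₁)) + oneCocycleClass _ (coc (root β₂) (hadm_root β₂)) := by
    intro β₁ β₂
    have hsum : ∀ σ : H, σ • (p • (root β₁ + root β₂)) = p • (root β₁ + root β₂) := fun σ ↦ by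
      rw [smul_add, smul_add, hadm_root, hadm_root]
    have e1 : oneCocycleClass _ (coc (root β₁) (hadm_root β₁)) + oneCocycleClass _ (coc (root β₂) (hadm_root β₂)) =
        oneCocycleClass _ (coc (root β₁ + root β₂) hsum) := by
      rw [← oneCocycleClass_add]
      congr 1
      apply Subtype.ext; apply ContinuousMap.ext; intro σ
      apply AddSubgroup.inclusion_injective (geomTorsion_le_geomPrimaryTorsion W p)
      change incl ((coc (root β₁) (hadm_root β₁)).1 σ + (coc (root β₂) (hadm_root β₂)).1 σ) =
        incl ((coc (root β₁ + root β₂) hsum).1 σ)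
      rw [map_add]
      change (σ • root β₁ - root β₁) + (σ • root β₂ - root β₂) = σ • (root β₁ + root β₂) - (root β₁ + root β₂)
      rw [smul_add]; abel
    rw [e1]
    refine hcls _ _ (hadm_root _) hsum 0 (fun σ ↦ smul_zero _) ?_
    rw [sub_zero, smul_sub, hroot, smul_add, hroot, hroot, AddSubgroup.coe_add, sub_self]
  let θ : B →+ subgroupH1 H (geomTorsion W (p : ℤ)) :=
    { toFun := fun β ↦ oneCocycleClass _ (coc (root β) (hadm_root β))
      map_zero' := by
        have h0 : ∀ σ : H, σ • (p • (0 : geomPrimaryTorsion W p)) = p • (0 : geomPrimaryTorsion W p) :=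
          fun σ ↦ by rw [smul_zero, smul_zero]
        have e : oneCocycleClass _ (coc (root 0) (hadm_root 0)) = oneCocycleClass _ (coc 0 h0) :=
          hcls _ _ (hadm_root 0) h0 0 (fun σ ↦ smul_zero _)
            (by rw [sub_zero, sub_zero, hroot, ZeroMemClass.coe_zero])
        rw [e]
        have hz : coc 0 h0 = 0 := by
          apply Subtype.ext; apply ContinuousMap.ext; intro σ
          apply AddSubgroup.inclusion_injective (geomTorsion_le_geomPrimaryTorsion W p)
          change σ • (0 : geomPrimaryTorsion W p) - 0 = incl 0
          rw [smul_zero, sub_zero, map_zero]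
        rw [hz, oneCocycleClass_zero]
      map_add' := hadd }
  have hθapply : ∀ β : B, θ β = oneCocycleClass _ (coc (root β) (hadm_root β)) := fun _ ↦ rfl
  -- `range θ = ker ι`
  have hrange : θ.range = ι.ker := by
    ext x
    constructor
    · rintro ⟨β, rfl⟩
      rw [AddMonoidHom.mem_ker, hθapply]
      exact hιcoc _ (hadm_root β)
    · intro hx
      obtain ⟨b, hb, rfl⟩ := hker x hx
      let β : B := ⟨p • b, fun σ ↦ hb σ⟩
      refine ⟨β, ?_⟩
      rw [hθapply]
      refine hcls _ _ (hadm_root β) hb 0 (fun σ ↦ smul_zero _) ?_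
      rw [sub_zero, smul_sub, hroot, sub_self]
  -- `ker θ = pB`
  have hkerθ : θ.ker = mulp.range := by
    ext β
    rw [AddMonoidHom.mem_ker, hθapply, oneCocycleClass_eq_zero_iff]
    constructor
    · rintro ⟨m, hm⟩
      -- `σ (root β) − root β = σ m − m`: `root β − m` is `G`-fixed and `p (root β − m) = β`
      have hfix : ∀ σ : H, σ • (root β - incl m) = root β - incl m := fun σ ↦ by
        have h := congrArg incl (hm σ)
        change incl ((coc (root β) (hadm_root β)).1 σ) = incl (σ • m - m) at h
        rw [map_sub] at h
        change σ • root β - root β = σ • incl m - incl m at h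
        rw [sub_eq_sub_iff_sub_eq_sub] at h
        rw [smul_sub]
        exact h
      refine ⟨⟨root β - incl m, hfix⟩, Subtype.ext ?_⟩
      rw [hmulp_apply, AddSubgroupClass.coe_nsmul]
      change p • (root β - incl m) = (β : geomPrimaryTorsion W p)
      have hpm : p • incl m = 0 := Subtype.ext (by
        rw [AddSubgroupClass.coe_nsmul, ZeroMemClass.coe_zero]
        exact AddSubgroup.torsionBy.nsmul_iff.mp m.2)
      rw [smul_sub, hpm, sub_zero, hroot]
    · rintro ⟨β', rfl⟩
      -- `β = p β'` with `β'` fixed: `root β − β' ∈ E[p]` and `∂ β' = 0`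
      have hpe : p • (root (mulp β') - (β' : geomPrimaryTorsion W p)) = 0 := by
        rw [smul_sub, hroot, hmulp_apply, AddSubgroupClass.coe_nsmul, sub_self]
      have he : (((root (mulp β') - (β' : geomPrimaryTorsion W p) : geomPrimaryTorsion W p)) : geomPoints W) ∈
          geomTorsion W (p : ℤ) :=
        AddSubgroup.torsionBy.nsmul_iff.mpr (by rw [← AddSubgroupClass.coe_nsmul, hpe, ZeroMemClass.coe_zero])
      refine ⟨⟨_, he⟩, fun σ ↦ ?_⟩
      apply AddSubgroup.inclusion_injective (geomTorsion_le_geomPrimaryTorsion W p)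
      change incl ((coc (root (mulp β')) (hadm_root (mulp β'))).1 σ) = incl (σ • _ - _)
      rw [map_sub]
      change σ • root (mulp β') - root (mulp β') =
        σ • (root (mulp β') - (β' : geomPrimaryTorsion W p)) - (root (mulp β') - (β' : geomPrimaryTorsion W p))
      rw [smul_sub, β'.2 σ]
      abel
  -- count: `B/pB = B/ker θ ≃ range θ = ker ι`
  have e1 : Nat.card (B ⧸ mulp.range) = Nat.card (B ⧸ θ.ker) :=
    Nat.card_congr (QuotientAddGroup.quotientAddEquivOfEq hkerθ.symm).toEquiv
  have e2 : Nat.card (B ⧸ θ.ker) = Nat.card θ.range :=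
    Nat.card_congr (QuotientAddGroup.quotientKerEquivRange θ).toEquiv
  have e3 : Nat.card θ.range = Nat.card ι.ker := by rw [hrange]
  rw [e1, e2, e3]

/-- **`#(B/pB) = #B[p]` for a FINITE abelian group `B`** (`p·` has kernel and cokernel of the same order).
[folklore] -/
theorem natCard_quotient_eq_natCard_pTorsion_of_finite {B : Type*} [AddCommGroup B] [Finite B] (n : ℕ) :
    Nat.card (B ⧸ (DistribSMul.toAddMonoidHom B n).range) =
      Nat.card (DistribSMul.toAddMonoidHom B n).ker := by
  set f : B →+ B := DistribSMul.toAddMonoidHom B n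
  have h1 : Nat.card B = Nat.card f.range * Nat.card (B ⧸ f.range) := by
    rw [mul_comm]; exact AddSubgroup.card_eq_card_quotient_mul_card_addSubgroup f.range
  have h2 : Nat.card B = Nat.card f.ker * Nat.card f.range := by
    rw [mul_comm, ← Nat.card_congr (QuotientAddGroup.quotientKerEquivRange f).toEquiv]
    exact AddSubgroup.card_eq_card_quotient_mul_card_addSubgroup f.ker
  have hpos : 0 < Nat.card f.range := Nat.card_pos
  rw [h2, mul_comm (Nat.card f.ker)] at h1
  exact (Nat.eq_of_mul_eq_mul_left hpos h1).symm

/-- **`#ker(H¹(G, E[p]) → H¹(G, E[p^∞])) = #E[p]^G` when `E[p^∞]^G` is FINITE** (`G = H ≤ D ≤ Γ_K`): the kernel has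
order `#(B/pB) = #B[p]` and `B[p] = E[p]^G`. [cite: GreenbergLNM1716, §3 proof of Lemma 3.1] -/
theorem natCard_ker_kummer_eq_natCard_fixed_torsion
    (hfin : (FixedPoints.addSubgroup H (W.geomPrimaryTorsion p) : Set (W.geomPrimaryTorsion p)).Finite) :
    Nat.card ((resH1Hom (ContinuousMonoidHom.id H)
        (AddSubgroup.inclusion (geomTorsion_le_geomPrimaryTorsion W p)) (fun _ _ ↦ rfl) :
          subgroupH1 H (geomTorsion W (p : ℤ)) →+ subgroupH1 H (W.geomPrimaryTorsion p)).ker) =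
      Nat.card (FixedPoints.addSubgroup H (geomTorsion W (p : ℤ))) := by
  haveI : Finite (FixedPoints.addSubgroup H (W.geomPrimaryTorsion p)) := hfin.to_subtype
  rw [natCard_ker_kummer_eq_natCard_quotient, natCard_quotient_eq_natCard_pTorsion_of_finite]
  -- `B[p] ≃ E[p]^G`
  set B : AddSubgroup (geomPrimaryTorsion W p) := FixedPoints.addSubgroup H (geomPrimaryTorsion W p)
  let incl := AddSubgroup.inclusion (geomTorsion_le_geomPrimaryTorsion W p)
  refine Nat.card_congr (Equiv.ofBijective (fun b ↦ (⟨⟨((b : B) : geomPrimaryTorsion W p),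
      AddSubgroup.torsionBy.nsmul_iff.mpr ?_⟩, fun σ ↦ ?_⟩ :
        FixedPoints.addSubgroup H (geomTorsion W (p : ℤ)))) ⟨fun b₁ b₂ h ↦ ?_, fun m ↦ ?_⟩)
  · have hb := (AddMonoidHom.mem_ker).mp b.2
    have hb' : p • ((b : B) : geomPrimaryTorsion W p) = 0 := congrArg (fun z : B ↦ (z : geomPrimaryTorsion W p)) hb
    rw [← AddSubgroupClass.coe_nsmul, hb', ZeroMemClass.coe_zero]
  · apply AddSubgroup.inclusion_injective (geomTorsion_le_geomPrimaryTorsion W p)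
    change σ • ((b : B) : geomPrimaryTorsion W p) = ((b : B) : geomPrimaryTorsion W p)
    exact (b : B).2 σ
  · have h' := congrArg (fun z : FixedPoints.addSubgroup H (geomTorsion W (p : ℤ)) ↦
      ((z : geomTorsion W (p : ℤ)) : geomPoints W)) h
    exact Subtype.ext (Subtype.ext (Subtype.ext h'))
  · have hm : p • incl (m : geomTorsion W (p : ℤ)) = 0 := Subtype.ext (by
      rw [AddSubgroupClass.coe_nsmul, ZeroMemClass.coe_zero]
      exact AddSubgroup.torsionBy.nsmul_iff.mp (m : geomTorsion W (p : ℤ)).2)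
    have hfix : ∀ σ : H, σ • incl (m : geomTorsion W (p : ℤ)) = incl (m : geomTorsion W (p : ℤ)) := fun σ ↦ by
      have h := m.2 σ
      change σ • (m : geomTorsion W (p : ℤ)) = (m : geomTorsion W (p : ℤ)) at h
      have hc : incl (σ • (m : geomTorsion W (p : ℤ))) = σ • incl (m : geomTorsion W (p : ℤ)) := rfl
      rw [← hc, h]
    refine ⟨⟨⟨incl (m : geomTorsion W (p : ℤ)), hfix⟩, (AddMonoidHom.mem_ker).mpr (Subtype.ext hm)⟩, ?_⟩
    apply Subtype.ext; apply Subtype.ext; rfl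

omit [W.IsElliptic] [Fact p.Prime] in
/-- **`#E₁[p]^G = #E₂[p]^G` along a `Γ_K`-equivariant `E₁[p] ≃ E₂[p]`** (`G = H ≤ D ≤ Γ_K` acts through `Γ_K`). [folklore] -/
theorem natCard_fixed_torsion_eq_of_torsionIso (W₁ W₂ : WeierstrassCurve K) (e : W₁.geomTorsion (p : ℤ) ≃+ W₂.geomTorsion (p : ℤ))
    (he : ∀ (σ : absoluteGaloisGroup K) (P : W₁.geomTorsion (p : ℤ)), e (σ • P) = σ • e P) :
    Nat.card (FixedPoints.addSubgroup H (W₁.geomTorsion (p : ℤ))) =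
      Nat.card (FixedPoints.addSubgroup H (W₂.geomTorsion (p : ℤ))) := by
  have he' : ∀ (σ : H) (P : W₁.geomTorsion (p : ℤ)), e (σ • P) = σ • e P := fun σ P ↦ he _ P
  refine Nat.card_congr (Equiv.ofBijective (fun m ↦ (⟨e m, fun σ ↦ ?_⟩ :
    FixedPoints.addSubgroup H (W₂.geomTorsion (p : ℤ)))) ⟨fun a b h ↦ ?_, fun m' ↦ ?_⟩)
  · change σ • e m = e m
    rw [← he', m.2 σ]
  · exact Subtype.ext (e.injective (congrArg Subtype.val h))
  · refine ⟨⟨e.symm m', fun σ ↦ ?_⟩, Subtype.ext (e.apply_symm_apply _)⟩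
    change σ • e.symm (m' : W₂.geomTorsion (p : ℤ)) = e.symm m'
    apply e.injective
    rw [he', e.apply_symm_apply]
    exact m'.2 σ

end Summit.BirchSwinnertonDyer.BirchSwinnertonDyer.Theorems.UniversalToricDescentLocalKummer

end
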